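import Literature.Probability.RandomPlanarGeometry.KlebanZagierDimension
import HarnessLib

/-!
# Thetanulls as `q̂`-series, their logarithmic derivatives, and `λ′ = πi ϑ₄⁴ λ`

Second file of the proof of the corrected Theorem 2 of P. Kleban, D. Zagier, *Crossing
probabilities and modular forms*, J. Stat. Phys. **113** (2003), 431–454, §5 (first file:
`KlebanZagierDimension.lean`, `0 < α ≤ 1/2`; third file: `KlebanZagierTheorem2.lean`, the
identification with the generalized Cardy function). Everything here is classical and PROVED;
the organising tool is the level-one norm `N(f) = f · f(·+1) · (f|₂TS)` of
`KlebanZagierDimension.lean`.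

* `Plus`/`Minus` (norm packaging): for `f` holomorphic on `ℍ` with `f(τ+2) = A f(τ)`:
  if `f(-1/τ) = τ² f(τ)` and `N(f) → 0` at `i∞` then `N(f) ∈ S₆(SL₂(ℤ)) = 0`, so `f = 0`
  (`eq_zero_plus`); if `f(-1/τ) = -τ² f(τ)` then `N(f)² = cΔ`, and `N(f)(it) = O(e^{-(π+δ)t})`
  forces `c = 0`, `f = 0` (`eq_zero_minus_of_fast_decay`). Laws of logarithmic derivatives
  under `τ ↦ τ + c` and `τ ↦ -1/τ` (`logDeriv_neg_one_div_law`: `(f′/f)(-1/τ) = τ²(f′/f)(τ) + 2τ`).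
* `ThetaZeroFree`: `θ₂θ₃θ₄ ≠ 0` on `ℍ` (`(θ₂θ₃θ₄)⁸ = cΔ`, tree `JacobiThetaNull.cuspF₂`).
* `ThetaSeries`: `θ₃(τ) = ∑ c3(m) q̂ᵐ`, `θ₄(τ) = ∑ c3(m) (-q̂)ᵐ`, `θ(τ/2,τ) = ∑ c2(k) q̂ᵏ`
  (`θ₂ = e^{πiτ/4} θ(τ/2,τ)`), `q̂ = e^{πiτ}`, from Mathlib's `jacobiTheta₂` series.
* `DiscDeriv`, `BigOqhat`: termwise derivative of a polynomially bounded power series and the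
  calculus of `F = c₀ + O(q̂)` uniformly high in `ℍ` (`IsBigOqhat`).
* `ThetaLogDeriv`: `θⱼ′/θⱼ` on `ℍ`: `θ₃′/θ₃, θ₄′/θ₄ = O(q̂)`, `θ₂′/θ₂ = πi/4 + O(q̂)`; the laws
  `(θ₃′/θ₃)(τ+1) = θ₄′/θ₄`, …, and `(θ₃′/θ₃)(-1/τ) = τ²(θ₃′/θ₃)(τ) + τ/2`,
  `(θ₄′/θ₄)(-1/τ) = τ²(θ₂′/θ₂)(τ) + τ/2`, `(θ₂′/θ₂)(-1/τ) = τ²(θ₄′/θ₄)(τ) + τ/2`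
  (differentiating the tree's `θⱼ(-1/τ) = (-iτ)^{1/2} θ_{σj}(τ)`).
* `LambdaDeriv`: **`λ′ = πi ϑ₄⁴ λ`** for `λ = θ₂⁴/θ₃⁴` in the form
  `4(θ₂′/θ₂ - θ₃′/θ₃) = πi θ₄⁴` (`four_mul_logDeriv_theta2_sub_theta3`; Kleban–Zagier §3,
  eq. (der)): the defect `z₃ = 4(θ₂′/θ₂ - θ₄′/θ₄) - πiθ₃⁴` is anti-invariant under `S`,
  `2`-periodic, and `N(z₃) = z₃ · z · z₂ = O(q̂³)`, so `eq_zero_minus_of_fast_decay` applies.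

## References

* P. Kleban, D. Zagier, *Crossing probabilities and modular forms*, J. Stat. Phys. 113 (2003),
  431–454, §§3–5. [KlebanZagier2003]
* D. F. Lawden, *Elliptic Functions and Applications*, Springer (1989), §1.5–1.6 (thetanulls).
  [Lawden1989]
-/

noncomputable section

open Complex Real Filter Topology Asymptotics Set

open scoped Real

namespace Literature.Probability.RandomPlanarGeometry.KlebanZagier

open Literature.NumberTheory.EllipticCurves.JacobiThetaNull (ne_zero_of_im_pos im_neg_one_div_pos
  cuspFormOf cuspFormOf_apply exists_eq_mul_discriminant eq_zero_of_cuspForm_weight_lt_twelve)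

/-! ### `ε = +1`: the norm is a level-one form of weight `6` -/

section Plus

variable {f : ℂ → ℂ} {A : ℂ}

/-- **`N(f)(τ+1) = N(f)(τ)`** from `f(τ+2) = A f(τ)`, `f(-1/τ) = τ² f(τ)`. [folklore] -/
theorem normTS_add_one_plus (hA : A ≠ 0)
    (hT2 : ∀ τ : ℂ, 0 < im τ → f (τ + 2) = A * f τ)
    (hS : ∀ τ : ℂ, 0 < im τ → f (-1 / τ) = τ ^ 2 * f τ) {τ : ℂ} (hτ : 0 < im τ) :
    normTS f (τ + 1) = normTS f τ := by
  have hτ0 : τ ≠ 0 := ne_zero_of_im_pos hτ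
  have hτ1 : τ + 1 ≠ 0 := ne_zero_of_im_pos (by simpa using hτ)
  have hσeq : -(τ + 1) / τ = -1 - 1 / τ := by
    rw [neg_add', sub_div, neg_div, div_self hτ0]
  have hσim : 0 < im (-(τ + 1) / τ) := by
    have h1 := im_neg_one_div_pos hτ
    have h2 : im (-(τ + 1) / τ) = im (-1 / τ) := by
      rw [hσeq, sub_im, neg_div, neg_im]
      simp
    rwa [h2]
  have e1 : (τ + 1 - 1) / (τ + 1) = -1 / (-(τ + 1) / τ) := by
    rw [add_sub_cancel_right, div_div_eq_mul_div, neg_one_mul, neg_div_neg_eq]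
  have e2 : (τ - 1) / τ = -(τ + 1) / τ + 2 := by
    rw [div_add' _ _ _ hτ0]
    congr 1
    ring
  have e3 : f (-(τ + 1) / τ) = A⁻¹ * f ((τ - 1) / τ) := by
    rw [e2, hT2 _ hσim, inv_mul_cancel_left₀ hA]
  have e4 : (-(τ + 1) / τ) ^ 2 * ((τ + 1) ^ 2)⁻¹ = (τ ^ 2)⁻¹ := by
    rw [div_pow, neg_sq, div_mul_eq_mul_div, mul_inv_cancel₀ (pow_ne_zero 2 hτ1), one_div]
  unfold normTS slashTS
  rw [e1, hS _ hσim, e3, show τ + 1 + 1 = τ + 2 by ring, hT2 τ hτ]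
  calc f (τ + 1) * (A * f τ) * (((τ + 1) ^ 2)⁻¹ * ((-(τ + 1) / τ) ^ 2 * (A⁻¹ * f ((τ - 1) / τ))))
      = (f τ * f (τ + 1) * (((-(τ + 1) / τ) ^ 2 * ((τ + 1) ^ 2)⁻¹) * f ((τ - 1) / τ))) *
          (A * A⁻¹) := by ring
    _ = f τ * f (τ + 1) * ((τ ^ 2)⁻¹ * f ((τ - 1) / τ)) := by
      rw [e4, mul_inv_cancel₀ hA, mul_one]

/-- **`N(f)(-1/τ) = τ⁶ N(f)(τ)`** from `f(-1/τ) = τ² f(τ)`. [folklore] -/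
theorem normTS_neg_one_div_plus
    (hS : ∀ τ : ℂ, 0 < im τ → f (-1 / τ) = τ ^ 2 * f τ) {τ : ℂ} (hτ : 0 < im τ) :
    normTS f (-1 / τ) = τ ^ 6 * normTS f τ := by
  have hτ0 : τ ≠ 0 := ne_zero_of_im_pos hτ
  have e1 : -1 / τ + 1 = (τ - 1) / τ := by
    rw [div_add' _ _ _ hτ0]
    congr 1
    ring
  have e2 : (-1 / τ - 1) / (-1 / τ) = τ + 1 := by
    rw [div_eq_iff (div_ne_zero (by norm_num) hτ0), div_sub' hτ0, mul_div_assoc',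
      div_eq_div_iff hτ0 hτ0]
    ring
  have e3 : ((-1 / τ) ^ 2)⁻¹ = τ ^ 2 := by
    rw [div_pow, neg_one_sq, one_div, inv_inv]
  unfold normTS slashTS
  rw [e1, e2, e3, hS τ hτ]
  have e5 : τ ^ 6 * (τ ^ 2)⁻¹ = τ ^ 4 := by
    rw [show τ ^ 6 = τ ^ 4 * τ ^ 2 by ring, mul_inv_cancel_right₀ (pow_ne_zero 2 hτ0)]
  calc τ ^ 2 * f τ * f ((τ - 1) / τ) * (τ ^ 2 * f (τ + 1))
      = τ ^ 4 * (f τ * f (τ + 1) * f ((τ - 1) / τ)) := by ring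
    _ = τ ^ 6 * (τ ^ 2)⁻¹ * (f τ * f (τ + 1) * f ((τ - 1) / τ)) := by rw [e5]
    _ = τ ^ 6 * (f τ * f (τ + 1) * ((τ ^ 2)⁻¹ * f ((τ - 1) / τ))) := by ring

/-- `N(f)(τ + n) = N(f)(τ)` for integers `n` (`ε = +1`). [folklore] -/
theorem normTS_add_int_plus (hA : A ≠ 0)
    (hT2 : ∀ τ : ℂ, 0 < im τ → f (τ + 2) = A * f τ)
    (hS : ∀ τ : ℂ, 0 < im τ → f (-1 / τ) = τ ^ 2 * f τ) {τ : ℂ} (hτ : 0 < im τ) (n : ℤ) :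
    normTS f (τ + n) = normTS f τ := by
  have hnat : ∀ (σ : ℂ), 0 < im σ → ∀ k : ℕ, normTS f (σ + k) = normTS f σ := by
    intro σ hσ k
    induction k with
    | zero => simp
    | succ k ih =>
      have hσk : 0 < im (σ + k) := by simpa using hσ
      rw [show σ + ((k + 1 : ℕ) : ℂ) = σ + k + 1 by push_cast; ring,
        normTS_add_one_plus hA hT2 hS hσk, ih]
  obtain ⟨k, rfl | rfl⟩ := Int.eq_nat_or_neg n
  · exact_mod_cast hnat τ hτ k
  · have hτk : 0 < im (τ + ((-(k : ℤ) : ℤ) : ℂ)) := by simpa using hτ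
    have := hnat _ hτk k
    rw [show τ + ((-(k : ℤ) : ℤ) : ℂ) + (k : ℂ) = τ by push_cast; ring] at this
    exact this.symm

/-- `N(f)` extended by `0` off `ℍ`. [folklore] -/
def normExt (f : ℂ → ℂ) (τ : ℂ) : ℂ := if 0 < im τ then normTS f τ else 0

/-- **`ε = +1`: `N(f) = 0`.** If `f` is holomorphic on `ℍ` with `f(τ+2) = A f(τ)`,
`f(-1/τ) = τ² f(τ)`, and `‖N(f)(τ)‖ ≤ B(Im τ)` for `0 ≤ Re τ < 1 ≤ Im τ` with `B → 0`, then
`N(f)` is a level-one cusp form of weight `6 < 12`, hence vanishes identically on `ℍ`. [folklore] -/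
theorem normTS_eq_zero_plus (hA : A ≠ 0)
    (hhol : ∀ τ : ℂ, 0 < im τ → DifferentiableAt ℂ f τ)
    (hT2 : ∀ τ : ℂ, 0 < im τ → f (τ + 2) = A * f τ)
    (hS : ∀ τ : ℂ, 0 < im τ → f (-1 / τ) = τ ^ 2 * f τ)
    {B : ℝ → ℝ} (hB : Tendsto B atTop (𝓝 0)) {Y₀ : ℝ} (hY₀ : 0 < Y₀)
    (hbound : ∀ τ : ℂ, Y₀ ≤ im τ → 0 ≤ re τ → re τ < 1 → ‖normTS f τ‖ ≤ B (im τ))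
    {τ : ℂ} (hτ : 0 < im τ) : normTS f τ = 0 := by
  have hT : ∀ τ : ℂ, normExt f (τ + 1) = normExt f τ := by
    intro τ
    by_cases hτ : 0 < im τ
    · have hτ1 : 0 < im (τ + 1) := by simpa using hτ
      simp only [normExt, if_pos hτ, if_pos hτ1, normTS_add_one_plus hA hT2 hS hτ]
    · have hτ1 : ¬ 0 < im (τ + 1) := by simpa using hτ
      simp only [normExt, if_neg hτ, if_neg hτ1]
  have hS' : ∀ τ : ℂ, 0 < im τ → normExt f (-1 / τ) = τ ^ 6 * normExt f τ := by
    intro τ hτ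
    simp only [normExt, if_pos hτ, if_pos (im_neg_one_div_pos hτ), normTS_neg_one_div_plus hS hτ]
  have hhol' : ∀ τ : ℂ, 0 < im τ → DifferentiableAt ℂ (normExt f) τ := by
    intro τ hτ
    have hev : normExt f =ᶠ[𝓝 τ] fun z => normTS f z := by
      filter_upwards [isOpen_upperHalfPlaneSet'.mem_nhds hτ] with z hz
      simp only [normExt, if_pos (show 0 < im z from hz)]
    exact hev.differentiableAt_iff.mpr (differentiableAt_normTS hhol hτ)
  have hzero : Tendsto (normExt f) (comap im atTop) (𝓝 0) := by
    refine squeeze_zero_norm' ?_ (hB.comp tendsto_comap)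
    have hmem : {τ : ℂ | Y₀ ≤ im τ} ∈ comap im atTop := ⟨Set.Ici Y₀, Ici_mem_atTop Y₀, fun τ h => h⟩
    filter_upwards [hmem] with τ hτ
    have hτ1 : Y₀ ≤ im τ := hτ
    have hτ' : 0 < im τ := by linarith
    -- reduce to `0 ≤ re τ < 1`
    set τ₀ : ℂ := τ + ((-⌊re τ⌋ : ℤ) : ℂ) with hτ₀
    have hτ₀im : im τ₀ = im τ := by simp [hτ₀]
    have hτ₀re : re τ₀ = Int.fract (re τ) := by
      show re τ₀ = re τ - ⌊re τ⌋
      rw [hτ₀, add_re, Complex.intCast_re, Int.cast_neg]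
      ring
    have hre0 : 0 ≤ re τ₀ := by rw [hτ₀re]; exact Int.fract_nonneg _
    have hre1 : re τ₀ < 1 := by rw [hτ₀re]; exact Int.fract_lt_one _
    have hper : normTS f τ = normTS f τ₀ := (normTS_add_int_plus hA hT2 hS hτ' _).symm
    simp only [normExt, if_pos hτ', Function.comp]
    rw [hper, ← hτ₀im]
    exact hbound τ₀ (by rw [hτ₀im]; exact hτ1) hre0 hre1
  have := eq_zero_of_cuspForm_weight_lt_twelve 6 (by norm_num) (normExt f) hT hS' hhol' hzero hτ
  simpa [normExt, if_pos hτ] using this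

/-- **`ε = +1`: `f = 0`.** Under the hypotheses of `normTS_eq_zero_plus`, `f` vanishes on `ℍ`
(if `f ≢ 0` then `N(f) ≢ 0`, by isolated zeros). [folklore] -/
theorem eq_zero_plus (hA : A ≠ 0)
    (hhol : ∀ τ : ℂ, 0 < im τ → DifferentiableAt ℂ f τ)
    (hT2 : ∀ τ : ℂ, 0 < im τ → f (τ + 2) = A * f τ)
    (hS : ∀ τ : ℂ, 0 < im τ → f (-1 / τ) = τ ^ 2 * f τ)
    {B : ℝ → ℝ} (hB : Tendsto B atTop (𝓝 0)) {Y₀ : ℝ} (hY₀ : 0 < Y₀)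
    (hbound : ∀ τ : ℂ, Y₀ ≤ im τ → 0 ≤ re τ → re τ < 1 → ‖normTS f τ‖ ≤ B (im τ))
    {τ : ℂ} (hτ : 0 < im τ) : f τ = 0 := by
  by_contra hne
  obtain ⟨z, hz, hNz⟩ := exists_normTS_ne_zero hhol ⟨τ, hτ, hne⟩
  exact hNz (normTS_eq_zero_plus hA hhol hT2 hS hB hY₀ hbound hz)

end Plus

/-! ### `ε = -1` with a direct bound on the norm, and the fast-decay vanishing criterion -/

section Minus

variable {f : ℂ → ℂ} {A : ℂ}

/-- **`N(f)² = cΔ`** (`ε = -1`), with the decay of `N(f)` given directly in the strip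
`0 ≤ Re τ < 1`. [folklore] -/
theorem normTS_sq_eq_mul_discriminant_of_bound (hA : A ≠ 0)
    (hhol : ∀ τ : ℂ, 0 < im τ → DifferentiableAt ℂ f τ)
    (hT2 : ∀ τ : ℂ, 0 < im τ → f (τ + 2) = A * f τ)
    (hS : ∀ τ : ℂ, 0 < im τ → f (-1 / τ) = -τ ^ 2 * f τ)
    {B : ℝ → ℝ} (hB : Tendsto B atTop (𝓝 0)) {Y₀ : ℝ} (hY₀ : 0 < Y₀)
    (hbound : ∀ τ : ℂ, Y₀ ≤ im τ → 0 ≤ re τ → re τ < 1 → ‖normTS f τ‖ ≤ B (im τ)) :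
    ∃ c : ℂ, ∀ (τ : ℂ) (hτ : 0 < im τ),
      normTS f τ ^ 2 = c * ModularForm.discriminant ⟨τ, hτ⟩ := by
  have hT : ∀ τ : ℂ, normSqExt f (τ + 1) = normSqExt f τ := by
    intro τ
    by_cases hτ : 0 < im τ
    · have hτ1 : 0 < im (τ + 1) := by simpa using hτ
      simp only [normSqExt, if_pos hτ, if_pos hτ1, normTS_add_one hA hT2 hS hτ, neg_sq]
    · have hτ1 : ¬ 0 < im (τ + 1) := by simpa using hτ
      simp only [normSqExt, if_neg hτ, if_neg hτ1]
  have hS' : ∀ τ : ℂ, 0 < im τ → normSqExt f (-1 / τ) = τ ^ 12 * normSqExt f τ := by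
    intro τ hτ
    simp only [normSqExt, if_pos hτ, if_pos (im_neg_one_div_pos hτ), normTS_neg_one_div hS hτ]
    ring
  have hhol' : ∀ τ : ℂ, 0 < im τ → DifferentiableAt ℂ (normSqExt f) τ := by
    intro τ hτ
    have hev : normSqExt f =ᶠ[𝓝 τ] fun z => normTS f z ^ 2 := by
      filter_upwards [isOpen_upperHalfPlaneSet'.mem_nhds hτ] with z hz
      simp only [normSqExt, if_pos (show 0 < im z from hz)]
    exact hev.differentiableAt_iff.mpr ((differentiableAt_normTS hhol hτ).pow 2)
  have hzero : Tendsto (normSqExt f) (comap im atTop) (𝓝 0) := by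
    have hB2 : Tendsto (fun y => B y ^ 2) atTop (𝓝 0) := by
      simpa using hB.pow 2
    refine squeeze_zero_norm' ?_ (hB2.comp tendsto_comap)
    have hmem : {τ : ℂ | Y₀ ≤ im τ} ∈ comap im atTop := ⟨Set.Ici Y₀, Ici_mem_atTop Y₀, fun τ h => h⟩
    filter_upwards [hmem] with τ hτ
    have hτ1 : Y₀ ≤ im τ := hτ
    have hτ' : 0 < im τ := by linarith
    set τ₀ : ℂ := τ + ((-⌊re τ⌋ : ℤ) : ℂ) with hτ₀
    have hτ₀im : im τ₀ = im τ := by simp [hτ₀]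
    have hτ₀re : re τ₀ = Int.fract (re τ) := by
      show re τ₀ = re τ - ⌊re τ⌋
      rw [hτ₀, add_re, Complex.intCast_re, Int.cast_neg]
      ring
    have hre0 : 0 ≤ re τ₀ := by rw [hτ₀re]; exact Int.fract_nonneg _
    have hre1 : re τ₀ < 1 := by rw [hτ₀re]; exact Int.fract_lt_one _
    have hper : ‖normTS f τ‖ = ‖normTS f τ₀‖ := (norm_normTS_add_int hA hT2 hS hτ' _).symm
    simp only [normSqExt, if_pos hτ', Function.comp, norm_pow]
    rw [hper, ← hτ₀im]
    exact pow_le_pow_left₀ (norm_nonneg _) (hbound τ₀ (by rw [hτ₀im]; exact hτ1) hre0 hre1) 2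
  obtain ⟨c, hc⟩ := exists_eq_mul_discriminant (cuspFormOf (normSqExt f) hT hS' hhol' hzero)
  refine ⟨c, fun τ hτ => ?_⟩
  have := hc ⟨τ, hτ⟩
  rw [cuspFormOf_apply] at this
  simpa [normSqExt, if_pos hτ] using this

/-- **`ε = -1`, fast decay: `f = 0`.** If in addition to the hypotheses of
`normTS_sq_eq_mul_discriminant_of_bound` the norm decays on the axis faster than `e^{-πt}`,
`‖N(f)(it)‖ ≤ C e^{-(π+δ)t}` (`δ > 0`), then the constant in `N(f)² = cΔ` vanishes
(`|Δ(it)| ≳ e^{-2πt}`), so `N(f) = 0` and `f = 0` on `ℍ`. [folklore] -/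
theorem eq_zero_minus_of_fast_decay (hA : A ≠ 0)
    (hhol : ∀ τ : ℂ, 0 < im τ → DifferentiableAt ℂ f τ)
    (hT2 : ∀ τ : ℂ, 0 < im τ → f (τ + 2) = A * f τ)
    (hS : ∀ τ : ℂ, 0 < im τ → f (-1 / τ) = -τ ^ 2 * f τ)
    {B : ℝ → ℝ} (hB : Tendsto B atTop (𝓝 0)) {Y₀ : ℝ} (hY₀ : 0 < Y₀)
    (hbound : ∀ τ : ℂ, Y₀ ≤ im τ → 0 ≤ re τ → re τ < 1 → ‖normTS f τ‖ ≤ B (im τ))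
    (hfast : ∃ C δ : ℝ, 0 < δ ∧ ∀ t : ℝ, Y₀ ≤ t → ‖normTS f (I * t)‖ ≤ C * rexp (-((π + δ) * t)))
    {τ : ℂ} (hτ : 0 < im τ) : f τ = 0 := by
  obtain ⟨c, hc⟩ := normTS_sq_eq_mul_discriminant_of_bound hA hhol hT2 hS hB hY₀ hbound
  by_contra hne
  obtain ⟨τ₁, hτ₁, hN₁⟩ := exists_normTS_ne_zero hhol ⟨τ, hτ, hne⟩
  have hc0 : c ≠ 0 := by
    intro h0
    apply hN₁
    have := hc τ₁ hτ₁
    rw [h0, zero_mul] at this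
    exact pow_eq_zero_iff two_ne_zero |>.mp this
  obtain ⟨C, δ, hδ, hCt⟩ := hfast
  obtain ⟨C', hC'⟩ := ModularForm.exp_isBigO_discriminant.bound
  obtain ⟨A₀, hA₀⟩ := (UpperHalfPlane.atImInfty_mem _).mp hC'
  set C'' : ℝ := max C' 0 with hC''
  have hC''0 : 0 ≤ C'' := le_max_right _ _
  have hC0 : 0 ≤ C := by
    have h1 := hCt Y₀ le_rfl
    have h2 : 0 < rexp (-((π + δ) * Y₀)) := Real.exp_pos _
    by_contra hC
    have h3 : C * rexp (-((π + δ) * Y₀)) < 0 := mul_neg_of_neg_of_pos (lt_of_not_ge hC) h2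
    linarith [norm_nonneg (normTS f (I * Y₀))]
  -- along the axis: `e^{-2πt} ≤ C''/‖c‖ · C² e^{-2(π+δ)t}` for `t ≥ max A₀ Y₀`
  have hbd : ∀ t : ℝ, max A₀ Y₀ ≤ t → rexp (2 * δ * t) ≤ C'' / ‖c‖ * C ^ 2 := by
    intro t ht
    have ht1 : Y₀ ≤ t := le_trans (le_max_right _ _) ht
    have ht0 : 0 < t := by linarith
    have him : 0 < im (I * t : ℂ) := by simpa using ht0
    have himz : UpperHalfPlane.im ⟨I * t, him⟩ = t := by
      show (I * (t : ℂ)).im = t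
      simp
    have hz := hA₀ ⟨I * t, him⟩ (by rw [himz]; exact le_trans (le_max_left _ _) ht)
    simp only [Set.mem_setOf_eq] at hz
    rw [himz, Real.norm_of_nonneg (Real.exp_pos _).le] at hz
    have hΔ : ‖ModularForm.discriminant ⟨I * t, him⟩‖ = ‖normTS f (I * t)‖ ^ 2 / ‖c‖ := by
      have e := hc (I * t) him
      rw [eq_div_iff (norm_ne_zero_iff.mpr hc0), mul_comm, ← norm_pow, ← norm_mul, ← e]
    rw [hΔ] at hz
    have hN := hCt t ht1
    have key : rexp (-(2 * π * t)) ≤ C'' / ‖c‖ * (C * rexp (-((π + δ) * t))) ^ 2 := by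
      calc rexp (-(2 * π * t)) = rexp (-2 * π * t) := by ring_nf
        _ ≤ C' * (‖normTS f (I * t)‖ ^ 2 / ‖c‖) := hz
        _ ≤ C'' * (‖normTS f (I * t)‖ ^ 2 / ‖c‖) :=
            mul_le_mul_of_nonneg_right (le_max_left _ _) (by positivity)
        _ = C'' / ‖c‖ * ‖normTS f (I * t)‖ ^ 2 := by ring
        _ ≤ C'' / ‖c‖ * (C * rexp (-((π + δ) * t))) ^ 2 := by
            apply mul_le_mul_of_nonneg_left _ (div_nonneg hC''0 (norm_nonneg c))
            exact pow_le_pow_left₀ (norm_nonneg _) hN 2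
    have e1 : (C * rexp (-((π + δ) * t))) ^ 2 = C ^ 2 * (rexp (-(2 * π * t)) * rexp (-(2 * δ * t))) := by
      rw [mul_pow, ← Real.exp_add, ← Real.exp_nat_mul]
      congr 1
      congr 1
      push_cast
      ring
    rw [e1] at key
    have hpos : 0 < rexp (-(2 * π * t)) := Real.exp_pos _
    have key' : rexp (-(2 * π * t)) * 1 ≤ rexp (-(2 * π * t)) * (C'' / ‖c‖ * C ^ 2 * rexp (-(2 * δ * t))) := by
      rw [mul_one]
      calc rexp (-(2 * π * t)) ≤ C'' / ‖c‖ * (C ^ 2 * (rexp (-(2 * π * t)) * rexp (-(2 * δ * t)))) := key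
        _ = rexp (-(2 * π * t)) * (C'' / ‖c‖ * C ^ 2 * rexp (-(2 * δ * t))) := by ring
    have key'' := le_of_mul_le_mul_left key' hpos
    -- `1 ≤ D e^{-2δt}` gives `e^{2δt} ≤ D`
    have hexp : rexp (2 * δ * t) * rexp (-(2 * δ * t)) = 1 := by
      rw [← Real.exp_add, add_neg_cancel, Real.exp_zero]
    calc rexp (2 * δ * t) = rexp (2 * δ * t) * 1 := (mul_one _).symm
      _ ≤ rexp (2 * δ * t) * (C'' / ‖c‖ * C ^ 2 * rexp (-(2 * δ * t))) :=
          mul_le_mul_of_nonneg_left key'' (Real.exp_pos _).le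
      _ = C'' / ‖c‖ * C ^ 2 * (rexp (2 * δ * t) * rexp (-(2 * δ * t))) := by ring
      _ = C'' / ‖c‖ * C ^ 2 := by rw [hexp, mul_one]
  have hgrow : Tendsto (fun t : ℝ => rexp (2 * δ * t)) atTop atTop :=
    Real.tendsto_exp_atTop.comp (tendsto_id.const_mul_atTop (by positivity))
  have hev := hgrow.eventually (eventually_gt_atTop (C'' / ‖c‖ * C ^ 2))
  have hev2 : ∀ᶠ t : ℝ in atTop, rexp (2 * δ * t) ≤ C'' / ‖c‖ * C ^ 2 := by
    filter_upwards [eventually_ge_atTop (max A₀ Y₀)] with t ht using hbd t ht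
  obtain ⟨t, h1, h2⟩ := (hev2.and hev).exists
  exact absurd h1 (not_le.mpr h2)

end Minus

/-! ### Laws of logarithmic derivatives -/

section LogDeriv

variable {f : ℂ → ℂ} {A : ℂ}

/-- **`(f′/f)(τ + c) = (f′/f)(τ)`** from `f(τ + c) = A f(τ)` on `ℍ` (`c` real, `A ≠ 0`). [folklore] -/
theorem logDeriv_add_law (hA : A ≠ 0) {c : ℝ}
    (hhol : ∀ τ : ℂ, 0 < im τ → DifferentiableAt ℂ f τ)
    (hT : ∀ τ : ℂ, 0 < im τ → f (τ + c) = A * f τ) {τ : ℂ} (hτ : 0 < im τ) :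
    logDeriv f (τ + c) = logDeriv f τ := by
  have hev : (fun z => f (z + c)) =ᶠ[𝓝 τ] fun z => A * f z := by
    filter_upwards [isOpen_upperHalfPlaneSet'.mem_nhds hτ] with z hz using hT z hz
  have hd := hev.deriv_eq
  have h1 : HasDerivAt (fun z => f (z + c)) (deriv f (τ + c) * 1) τ := by
    have hτc : 0 < im (τ + c) := by simpa using hτ
    exact (hhol _ hτc).hasDerivAt.comp τ ((hasDerivAt_id τ).add_const (c : ℂ))
  have h2 : HasDerivAt (fun z => A * f z) (A * deriv f τ) τ := (hhol τ hτ).hasDerivAt.const_mul A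
  rw [h1.deriv, h2.deriv, mul_one] at hd
  rw [logDeriv_apply, logDeriv_apply, hd, hT τ hτ, mul_div_mul_left _ _ hA]

/-- **`(f′/f)(-1/τ) = τ² (f′/f)(τ) + 2τ`** from `f(-1/τ) = ε τ² f(τ)` on `ℍ`, at points where
`f(τ) ≠ 0` (`ε ≠ 0`): the logarithmic derivative of a weight-`2` form is quasi-modular. [folklore] -/
theorem logDeriv_neg_one_div_law {ε : ℂ} (hε : ε ≠ 0)
    (hhol : ∀ τ : ℂ, 0 < im τ → DifferentiableAt ℂ f τ)
    (hS : ∀ τ : ℂ, 0 < im τ → f (-1 / τ) = ε * τ ^ 2 * f τ) {τ : ℂ} (hτ : 0 < im τ)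
    (hf : f τ ≠ 0) :
    logDeriv f (-1 / τ) = τ ^ 2 * logDeriv f τ + 2 * τ := by
  have hτ0 : τ ≠ 0 := ne_zero_of_im_pos hτ
  have hev : (fun z => f (-1 / z)) =ᶠ[𝓝 τ] fun z => ε * z ^ 2 * f z := by
    filter_upwards [isOpen_upperHalfPlaneSet'.mem_nhds hτ] with z hz using hS z hz
  have hd := hev.deriv_eq
  have h0 : HasDerivAt (fun z : ℂ => -1 / z) (1 / τ ^ 2) τ := by
    have h := (hasDerivAt_inv hτ0).const_mul (-1 : ℂ)
    refine (h.congr_of_eventuallyEq ?_).congr_deriv (by ring)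
    exact Eventually.of_forall fun z => by simp [div_eq_mul_inv]
  have h1 : HasDerivAt (fun z => f (-1 / z)) (deriv f (-1 / τ) * (1 / τ ^ 2)) τ :=
    (hhol _ (im_neg_one_div_pos hτ)).hasDerivAt.comp τ h0
  have h2 : HasDerivAt (fun z => ε * z ^ 2 * f z) (ε * (2 * τ) * f τ + ε * τ ^ 2 * deriv f τ) τ := by
    have hp : HasDerivAt (fun z : ℂ => ε * z ^ 2) (ε * (2 * τ)) τ := by
      simpa using (hasDerivAt_pow 2 τ).const_mul ε
    exact hp.mul (hhol τ hτ).hasDerivAt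
  rw [h1.deriv, h2.deriv] at hd
  have hd' : deriv f (-1 / τ) = τ ^ 2 * (ε * (2 * τ) * f τ + ε * τ ^ 2 * deriv f τ) := by
    have := congrArg (· * τ ^ 2) hd
    rw [one_div, inv_mul_cancel_right₀ (pow_ne_zero 2 hτ0)] at this
    rw [this, mul_comm]
  rw [logDeriv_apply, logDeriv_apply, hd', hS τ hτ]
  field_simp
  ring

end LogDeriv

/-! ### `θ₂ θ₃ θ₄ ≠ 0` on `ℍ` -/

section ThetaZeroFree

open Literature.NumberTheory.EllipticCurves.JacobiThetaNull

/-- **`θ₂θ₃θ₄ ≠ 0` on `ℍ`**: `(θ₂θ₃θ₄)⁸` is a level-one cusp form of weight `12`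
(`JacobiThetaNull.cuspF₂`), hence `cΔ` with `c ≠ 0` (`e^{-πiτ/4}θ₂θ₃θ₄ → 2` at `i∞`), and
`Δ ≠ 0` (Mathlib). [folklore] -/
theorem thetaP_ne_zero {τ : ℂ} (hτ : 0 < im τ) : thetaP τ ≠ 0 := by
  obtain ⟨c, hc⟩ := exists_eq_mul_discriminant cuspF₂
  have hval : ∀ (z : ℂ) (hz : 0 < im z), thetaP z ^ 8 = c * ModularForm.discriminant ⟨z, hz⟩ := by
    intro z hz
    have := hc ⟨z, hz⟩
    rw [cuspF₂, cuspFormOf_apply] at this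
    exact this
  have hc0 : c ≠ 0 := by
    intro h0
    have hev : ∀ᶠ z : ℂ in comap im atTop, dist (cexp (-(π * I * z / 4)) * thetaP z) 2 < 1 :=
      tendsto_thetaP (Metric.ball_mem_nhds 2 one_pos)
    have him : ∀ᶠ z : ℂ in comap im atTop, 0 < im z := by
      filter_upwards [preimage_mem_comap (Ioi_mem_atTop (0 : ℝ))] with z hz using hz
    obtain ⟨z, hz1, hz2⟩ := (hev.and him).exists
    have hP : thetaP z = 0 := by
      have := hval z hz2
      rw [h0, zero_mul] at this
      exact pow_eq_zero_iff (by norm_num) |>.mp this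
    rw [hP, mul_zero, dist_comm, dist_eq_norm] at hz1
    norm_num at hz1
  intro hP
  have := hval τ hτ
  rw [hP, zero_pow (by norm_num)] at this
  exact (mul_ne_zero hc0 (ModularForm.discriminant_ne_zero ⟨τ, hτ⟩)) this.symm

/-- `θ₂ ≠ 0` on `ℍ`. [folklore] -/
theorem theta2_ne_zero' {τ : ℂ} (hτ : 0 < im τ) : theta2 τ ≠ 0 := fun h =>
  thetaP_ne_zero hτ (by simp [thetaP, h])

/-- `θ₃ ≠ 0` on `ℍ`. [folklore] -/
theorem theta3_ne_zero' {τ : ℂ} (hτ : 0 < im τ) : theta3 τ ≠ 0 := fun h =>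
  thetaP_ne_zero hτ (by simp [thetaP, h])

/-- `θ₄ ≠ 0` on `ℍ`. [folklore] -/
theorem theta4_ne_zero' {τ : ℂ} (hτ : 0 < im τ) : theta4 τ ≠ 0 := fun h =>
  thetaP_ne_zero hτ (by simp [thetaP, h])

end ThetaZeroFree

/-! ### The thetanulls as power series in `q̂` -/

section ThetaSeries

open Literature.NumberTheory.EllipticCurves.JacobiThetaNull

/-- Coefficient of `q̂ᵐ` in `θ₃ = ∑_{n∈ℤ} q̂^{n²}`: `1`, `2`, `0` as `m` is `0`, a non-zero square, a
non-square. [folklore] -/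
def c3 (m : ℕ) : ℂ := if m = 0 then 1 else if IsSquare m then 2 else 0

/-- `|c3 m| ≤ 2`. [folklore] -/
theorem norm_c3_le (m : ℕ) : ‖c3 m‖ ≤ 2 * ((m : ℝ) + 1) ^ 0 := by
  simp only [pow_zero, mul_one, c3]
  split_ifs <;> simp

/-- `c3 (n²)`. [folklore] -/
theorem c3_sq (n : ℕ) : c3 (n ^ 2) = if n = 0 then 1 else 2 := by
  by_cases hn : n = 0
  · simp [c3, hn]
  · have h2 : n ^ 2 ≠ 0 := pow_ne_zero 2 hn
    rw [c3, if_neg h2, if_pos ⟨n, sq n⟩, if_neg hn]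

/-- `c3` vanishes off the squares. [folklore] -/
theorem c3_eq_zero {m : ℕ} (hm : m ∉ Set.range fun n : ℕ => n ^ 2) : c3 m = 0 := by
  have h0 : m ≠ 0 := fun h => hm ⟨0, by simp [h]⟩
  have hsq : ¬ IsSquare m := fun ⟨r, hr⟩ => hm ⟨r, by show r ^ 2 = m; rw [hr, sq]⟩
  rw [c3, if_neg h0, if_neg hsq]

/-- The `ℤ`-indexed terms of `θ₃` as powers of `q̂`. [folklore] -/
theorem jacobiTheta₂_term_zero_eq (n : ℤ) (τ : ℂ) :
    jacobiTheta₂_term n 0 τ = qhat τ ^ (n.natAbs ^ 2) := by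
  rw [jacobiTheta₂_term, qhat, ← Complex.exp_nat_mul]
  congr 1
  have hsq : ((n : ℂ)) ^ 2 = ((n.natAbs : ℕ) : ℂ) ^ 2 := by
    rcases Int.natAbs_eq n with h | h
    · conv_lhs => rw [h]
      simp
    · conv_lhs => rw [h]
      simp
  push_cast
  rw [← hsq]
  ring

/-- **`θ₃(τ) = ∑ₘ c3(m) q̂ᵐ`** on `ℍ`. [folklore] -/
theorem theta3_eq_discFun {τ : ℂ} (hτ : 0 < im τ) : theta3 τ = discFun c3 (qhat τ) := by
  have h1 : HasSum (fun n : ℤ => jacobiTheta₂_term n 0 τ) (theta3 τ) := hasSum_jacobiTheta₂_term 0 hτ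
  simp_rw [jacobiTheta₂_term_zero_eq] at h1
  have h2 := h1.nat_add_neg
  have h2' : HasSum (fun n : ℕ => qhat τ ^ (n ^ 2) + qhat τ ^ (n ^ 2)) (theta3 τ + 1) := by
    have := h2
    simp only [Int.natAbs_neg, Int.natAbs_natCast, Int.natAbs_zero] at this
    simpa using this
  have h3 := h2'.sub (hasSum_ite_eq 0 (1 : ℂ))
  rw [add_sub_cancel_right] at h3
  have hinj : Function.Injective fun n : ℕ => n ^ 2 := Nat.pow_left_injective (by norm_num)
  have h4 : HasSum ((fun m : ℕ => c3 m * qhat τ ^ m) ∘ fun n : ℕ => n ^ 2) (theta3 τ) := by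
    have e : ((fun m : ℕ => c3 m * qhat τ ^ m) ∘ fun n : ℕ => n ^ 2) =
        fun n : ℕ => qhat τ ^ (n ^ 2) + qhat τ ^ (n ^ 2) - if n = 0 then (1 : ℂ) else 0 := by
      funext n
      simp only [Function.comp, c3_sq]
      split_ifs with hn
      · subst hn; simp
      · ring
    rw [e]
    exact h3
  have h5 := (hinj.hasSum_iff (f := fun m : ℕ => c3 m * qhat τ ^ m)
    (fun m hm => by rw [c3_eq_zero hm, zero_mul])).mp h4
  rw [discFun, h5.tsum_eq]

end ThetaSeries

section ThetaSeries2

open Literature.NumberTheory.EllipticCurves.JacobiThetaNull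

/-- **`θ₄(τ) = ∑ₘ c3(m) (-q̂)ᵐ`** on `ℍ` (`θ₄(τ) = θ₃(τ+1)`, `q̂(τ+1) = -q̂(τ)`). [folklore] -/
theorem theta4_eq_discFun {τ : ℂ} (hτ : 0 < im τ) : theta4 τ = discFun c3 (-qhat τ) := by
  rw [← theta3_add_one, theta3_eq_discFun (by simpa using hτ), qhat_add_one]

/-- Coefficient of `q̂ᵏ` in `θ(τ/2, τ) = ∑_{n∈ℤ} q̂^{n²+n}`: `2` on the pronic numbers `n(n+1)`,
`0` elsewhere. [folklore] -/
def c2 (k : ℕ) : ℂ := by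
  classical
  exact if k ∈ Set.range (fun n : ℕ => n * (n + 1)) then 2 else 0

/-- `c2 (n(n+1)) = 2`. [folklore] -/
theorem c2_pronic (n : ℕ) : c2 (n * (n + 1)) = 2 := by
  simp only [c2]
  rw [if_pos ⟨n, rfl⟩]

/-- `c2 0 = 2`. [folklore] -/
theorem c2_zero : c2 0 = 2 := by simpa using c2_pronic 0

/-- `c2` vanishes off the pronic numbers. [folklore] -/
theorem c2_eq_zero {k : ℕ} (hk : k ∉ Set.range fun n : ℕ => n * (n + 1)) : c2 k = 0 := by
  simp only [c2]
  rw [if_neg hk]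

/-- `|c2 k| ≤ 2`. [folklore] -/
theorem norm_c2_le (k : ℕ) : ‖c2 k‖ ≤ 2 * ((k : ℝ) + 1) ^ 0 := by
  simp only [pow_zero, mul_one, c2]
  split_ifs <;> simp

/-- `n ↦ n(n+1)` is injective on `ℕ`. [folklore] -/
theorem pronic_injective : Function.Injective fun n : ℕ => n * (n + 1) := by
  apply StrictMono.injective
  intro a b hab
  exact Nat.mul_lt_mul'' hab (Nat.succ_lt_succ hab)

/-- The `ℤ`-indexed terms of `θ(τ/2, τ)`, non-negative indices. [folklore] -/
theorem jacobiTheta₂_term_half_nat (n : ℕ) (τ : ℂ) :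
    jacobiTheta₂_term (n : ℤ) (τ / 2) τ = qhat τ ^ (n * (n + 1)) := by
  rw [jacobiTheta₂_term, qhat, ← Complex.exp_nat_mul]
  congr 1
  push_cast
  ring

/-- The `ℤ`-indexed terms of `θ(τ/2, τ)`, negative indices. [folklore] -/
theorem jacobiTheta₂_term_half_negSucc (n : ℕ) (τ : ℂ) :
    jacobiTheta₂_term (-((n : ℤ) + 1)) (τ / 2) τ = qhat τ ^ (n * (n + 1)) := by
  rw [jacobiTheta₂_term, qhat, ← Complex.exp_nat_mul]
  congr 1
  push_cast
  ring

/-- **`θ(τ/2, τ) = ∑ₖ c2(k) q̂ᵏ`** on `ℍ`. [folklore] -/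
theorem jacobiTheta₂_half_eq_discFun {τ : ℂ} (hτ : 0 < im τ) :
    jacobiTheta₂ (τ / 2) τ = discFun c2 (qhat τ) := by
  have h1 := (hasSum_jacobiTheta₂_term (τ / 2) hτ).nat_add_neg_add_one
  have h2 : HasSum (fun n : ℕ => qhat τ ^ (n * (n + 1)) + qhat τ ^ (n * (n + 1)))
      (jacobiTheta₂ (τ / 2) τ) := by
    have e : (fun n : ℕ => jacobiTheta₂_term (n : ℤ) (τ / 2) τ +
        jacobiTheta₂_term (-((n : ℤ) + 1)) (τ / 2) τ) =
        fun n : ℕ => qhat τ ^ (n * (n + 1)) + qhat τ ^ (n * (n + 1)) := by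
      funext n
      rw [jacobiTheta₂_term_half_nat, jacobiTheta₂_term_half_negSucc]
    rw [← e]
    exact h1
  have h3 : HasSum ((fun k : ℕ => c2 k * qhat τ ^ k) ∘ fun n : ℕ => n * (n + 1))
      (jacobiTheta₂ (τ / 2) τ) := by
    have e : ((fun k : ℕ => c2 k * qhat τ ^ k) ∘ fun n : ℕ => n * (n + 1)) =
        fun n : ℕ => qhat τ ^ (n * (n + 1)) + qhat τ ^ (n * (n + 1)) := by
      funext n
      simp only [Function.comp, c2_pronic]
      ring
    rw [e]
    exact h2
  have h4 := (pronic_injective.hasSum_iff (f := fun k : ℕ => c2 k * qhat τ ^ k)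
    (fun k hk => by rw [c2_eq_zero hk, zero_mul])).mp h3
  rw [discFun, h4.tsum_eq]

/-- **`θ₂(τ) = e^{πiτ/4} ∑ₖ c2(k) q̂ᵏ`** on `ℍ`. [folklore] -/
theorem theta2_eq_discFun {τ : ℂ} (hτ : 0 < im τ) :
    theta2 τ = cexp (π * I * τ / 4) * discFun c2 (qhat τ) := by
  rw [theta2, jacobiTheta₂_half_eq_discFun hτ]

end ThetaSeries2

/-! ### The derivative of a polynomially bounded power series -/

section DiscDeriv

variable {c : ℕ → ℂ} {C : ℝ} {m : ℕ}

/-- The coefficients `(n+1) c_{n+1}` of the derivative series. [folklore] -/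
def derivCoef (c : ℕ → ℂ) (n : ℕ) : ℂ := c (n + 1) * ((n : ℂ) + 1)

/-- `‖(n+1) c_{n+1}‖ ≤ 2ᵐ C (n+1)^{m+1}`. [folklore] -/
theorem norm_derivCoef_le (hc : ∀ n, ‖c n‖ ≤ C * ((n : ℝ) + 1) ^ m) (hC : 0 ≤ C) (n : ℕ) :
    ‖derivCoef c n‖ ≤ 2 ^ m * C * ((n : ℝ) + 1) ^ (m + 1) := by
  rw [derivCoef, norm_mul]
  have h1 := norm_shift_le hc hC n
  have h2 : ‖((n : ℂ) + 1)‖ = (n : ℝ) + 1 := by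
    rw [show ((n : ℂ) + 1) = (((n : ℝ) + 1 : ℝ) : ℂ) by push_cast; ring, Complex.norm_real,
      Real.norm_of_nonneg (by positivity)]
  rw [h2, pow_succ]
  calc ‖c (n + 1)‖ * ((n : ℝ) + 1) ≤ 2 ^ m * C * ((n : ℝ) + 1) ^ m * ((n : ℝ) + 1) :=
        mul_le_mul_of_nonneg_right h1 (by positivity)
    _ = _ := by ring

/-- **Termwise derivative**: `(∑ cₙ wⁿ)′ = ∑ (n+1) c_{n+1} wⁿ` on the open unit disc. [folklore] -/
theorem hasSum_deriv_discFun (hc : ∀ n, ‖c n‖ ≤ C * ((n : ℝ) + 1) ^ m) (hC : 0 ≤ C) {w : ℂ}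
    (hw : ‖w‖ < 1) : HasSum (fun n : ℕ => derivCoef c n * w ^ n) (deriv (discFun c) w) := by
  set ρ : ℝ := (‖w‖ + 1) / 2 with hρ
  have hρ0 : 0 ≤ ρ := by positivity
  have hρ1 : ρ < 1 := by rw [hρ]; linarith [norm_nonneg w]
  have hwρ : ‖w‖ < ρ := by rw [hρ]; linarith
  have hmem : w ∈ Metric.ball (0 : ℂ) ρ := by rwa [Metric.mem_ball, dist_zero_right]
  have h := hasSum_deriv_of_summable_norm (F := fun n z => c n * z ^ n)
    (hasSum_discMajorant C m hρ0 hρ1).summable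
    (fun n => ((differentiable_const (c n)).mul (differentiable_pow n)).differentiableOn)
    Metric.isOpen_ball (fun n z hz => by
      rw [Metric.mem_ball, dist_zero_right] at hz
      exact norm_term_le_discMajorant hc hC hz.le n) hmem
  have h' := (hasSum_nat_add_iff' 1).mpr h
  rw [Finset.sum_range_one] at h'
  have e0 : deriv (fun z : ℂ => c 0 * z ^ 0) w = 0 := by simp
  rw [e0, sub_zero] at h'
  have e : (fun n : ℕ => derivCoef c n * w ^ n) =
      fun n : ℕ => deriv (fun z : ℂ => c (n + 1) * z ^ (n + 1)) w := by
    funext n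
    rw [deriv_const_mul _ (differentiableAt_pow (n + 1)), deriv_pow_field, derivCoef,
      Nat.add_sub_cancel]
    push_cast
    ring
  rw [e]
  exact h'

/-- `(∑ cₙ wⁿ)′ = ∑ (n+1) c_{n+1} wⁿ` as an identity of functions on the disc. [folklore] -/
theorem deriv_discFun_eq (hc : ∀ n, ‖c n‖ ≤ C * ((n : ℝ) + 1) ^ m) (hC : 0 ≤ C) {w : ℂ}
    (hw : ‖w‖ < 1) : deriv (discFun c) w = discFun (derivCoef c) w :=
  (hasSum_deriv_discFun hc hC hw).unique
    (hasSum_discFun (norm_derivCoef_le hc hC) (by positivity) hw)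

end DiscDeriv

/-! ### `F = c₀ + O(q̂)` uniformly high in the upper half-plane -/

section BigOqhat

/-- `F(τ) = c₀ + O(e^{-π Im τ})` uniformly in `Re τ`, for `Im τ` large. [folklore] -/
def IsBigOqhat (F : ℂ → ℂ) (c₀ : ℂ) : Prop :=
  ∃ C Y : ℝ, ∀ τ : ℂ, Y ≤ im τ → ‖F τ - c₀‖ ≤ C * rexp (-(π * im τ))

namespace IsBigOqhat

variable {F G : ℂ → ℂ} {a b : ℂ}

/-- Non-negativity of the constant may be assumed. [folklore] -/
theorem bound' (h : IsBigOqhat F a) :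
    ∃ C Y : ℝ, 0 ≤ C ∧ 0 < Y ∧ ∀ τ : ℂ, Y ≤ im τ → ‖F τ - a‖ ≤ C * rexp (-(π * im τ)) := by
  obtain ⟨C, Y, h⟩ := h
  refine ⟨max C 0, max Y 1, le_max_right _ _, lt_of_lt_of_le one_pos (le_max_right _ _),
    fun τ hτ => (h τ (le_trans (le_max_left _ _) hτ)).trans ?_⟩
  exact mul_le_mul_of_nonneg_right (le_max_left _ _) (Real.exp_pos _).le

/-- Transfer along an equality on `ℍ`. [folklore] -/
theorem congr' (h : IsBigOqhat F a) (hFG : ∀ τ : ℂ, 0 < im τ → F τ = G τ) : IsBigOqhat G a := by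
  obtain ⟨C, Y, hC, hY, h⟩ := h.bound'
  exact ⟨C, Y, fun τ hτ => by rw [← hFG τ (lt_of_lt_of_le hY hτ)]; exact h τ hτ⟩

/-- Constants. [folklore] -/
theorem const (a : ℂ) : IsBigOqhat (fun _ => a) a := ⟨0, 0, fun τ _ => by simp⟩

/-- Sums. [folklore] -/
theorem add (hF : IsBigOqhat F a) (hG : IsBigOqhat G b) :
    IsBigOqhat (fun τ => F τ + G τ) (a + b) := by
  obtain ⟨C₁, Y₁, h₁⟩ := hF
  obtain ⟨C₂, Y₂, h₂⟩ := hG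
  refine ⟨C₁ + C₂, max Y₁ Y₂, fun τ hτ => ?_⟩
  have e : F τ + G τ - (a + b) = (F τ - a) + (G τ - b) := by ring
  rw [e, add_mul]
  exact (norm_add_le _ _).trans (add_le_add (h₁ τ (le_trans (le_max_left _ _) hτ))
    (h₂ τ (le_trans (le_max_right _ _) hτ)))

/-- Scalar multiples. [folklore] -/
theorem const_mul (k : ℂ) (hF : IsBigOqhat F a) : IsBigOqhat (fun τ => k * F τ) (k * a) := by
  obtain ⟨C, Y, h⟩ := hF
  refine ⟨‖k‖ * C, Y, fun τ hτ => ?_⟩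
  rw [← mul_sub, norm_mul, mul_assoc]
  exact mul_le_mul_of_nonneg_left (h τ hτ) (norm_nonneg _)

/-- Negation. [folklore] -/
theorem neg (hF : IsBigOqhat F a) : IsBigOqhat (fun τ => -F τ) (-a) := by
  have := hF.const_mul (-1)
  simpa using this

/-- Differences. [folklore] -/
theorem sub (hF : IsBigOqhat F a) (hG : IsBigOqhat G b) :
    IsBigOqhat (fun τ => F τ - G τ) (a - b) := by
  have := hF.add hG.neg
  simpa [sub_eq_add_neg] using this

/-- A uniform bound high up. [folklore] -/
theorem norm_le (hF : IsBigOqhat F a) :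
    ∃ M Y : ℝ, 0 ≤ M ∧ 0 < Y ∧ ∀ τ : ℂ, Y ≤ im τ → ‖F τ‖ ≤ M := by
  obtain ⟨C, Y, hC, hY, h⟩ := hF.bound'
  refine ⟨‖a‖ + C, Y, by positivity, hY, fun τ hτ => ?_⟩
  have h1 := h τ hτ
  have h2 : rexp (-(π * im τ)) ≤ 1 := by
    rw [← Real.exp_zero]
    exact Real.exp_le_exp.mpr (by nlinarith [Real.pi_pos, lt_of_lt_of_le hY hτ])
  calc ‖F τ‖ = ‖(F τ - a) + a‖ := by ring_nf
    _ ≤ ‖F τ - a‖ + ‖a‖ := norm_add_le _ _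
    _ ≤ C * 1 + ‖a‖ := by nlinarith [mul_le_mul_of_nonneg_left h2 hC]
    _ = ‖a‖ + C := by ring

/-- Products. [folklore] -/
theorem mul (hF : IsBigOqhat F a) (hG : IsBigOqhat G b) :
    IsBigOqhat (fun τ => F τ * G τ) (a * b) := by
  obtain ⟨M, Y₀, hM, hY₀, hGb⟩ := hG.norm_le
  obtain ⟨C₁, Y₁, hC₁, hY₁, h₁⟩ := hF.bound'
  obtain ⟨C₂, Y₂, hC₂, hY₂, h₂⟩ := hG.bound'
  refine ⟨C₁ * M + ‖a‖ * C₂, max Y₀ (max Y₁ Y₂), fun τ hτ => ?_⟩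
  have hτ0 : Y₀ ≤ im τ := le_trans (le_max_left _ _) hτ
  have hτ1 : Y₁ ≤ im τ := le_trans (le_trans (le_max_left _ _) (le_max_right _ _)) hτ
  have hτ2 : Y₂ ≤ im τ := le_trans (le_trans (le_max_right _ _) (le_max_right _ _)) hτ
  have e : F τ * G τ - a * b = (F τ - a) * G τ + a * (G τ - b) := by ring
  rw [e, add_mul]
  refine (norm_add_le _ _).trans (add_le_add ?_ ?_)
  · rw [norm_mul]
    calc ‖F τ - a‖ * ‖G τ‖ ≤ C₁ * rexp (-(π * im τ)) * M :=
          mul_le_mul (h₁ τ hτ1) (hGb τ hτ0) (norm_nonneg _) (by positivity)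
      _ = C₁ * M * rexp (-(π * im τ)) := by ring
  · rw [norm_mul]
    calc ‖a‖ * ‖G τ - b‖ ≤ ‖a‖ * (C₂ * rexp (-(π * im τ))) :=
          mul_le_mul_of_nonneg_left (h₂ τ hτ2) (norm_nonneg _)
      _ = ‖a‖ * C₂ * rexp (-(π * im τ)) := by ring

/-- Powers. [folklore] -/
theorem pow (hF : IsBigOqhat F a) (n : ℕ) : IsBigOqhat (fun τ => F τ ^ n) (a ^ n) := by
  induction n with
  | zero => simpa using const (1 : ℂ)
  | succ n ih => simpa [pow_succ] using ih.mul hF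

/-- Inverses of functions with non-zero limit. [folklore] -/
theorem inv (hG : IsBigOqhat G b) (hb : b ≠ 0) : IsBigOqhat (fun τ => (G τ)⁻¹) b⁻¹ := by
  obtain ⟨C, Y, hC, hY, h⟩ := hG.bound'
  have hb0 : 0 < ‖b‖ := norm_pos_iff.mpr hb
  -- choose `Y₁` with `C e^{-π y} ≤ ‖b‖/2` for `y ≥ Y₁`
  have hev : ∀ᶠ y : ℝ in atTop, C * rexp (-(π * y)) ≤ ‖b‖ / 2 := by
    have ht : Tendsto (fun y : ℝ => C * rexp (-(π * y))) atTop (𝓝 (C * 0)) := by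
      refine (Real.tendsto_exp_atBot.comp ?_).const_mul C
      exact tendsto_neg_atTop_atBot.comp (tendsto_id.const_mul_atTop Real.pi_pos)
    rw [mul_zero] at ht
    exact ht.eventually (Iic_mem_nhds (by positivity))
  obtain ⟨Y₁, hY₁⟩ := eventually_atTop.mp hev
  refine ⟨2 * C / ‖b‖ ^ 2, max Y Y₁, fun τ hτ => ?_⟩
  have hτY : Y ≤ im τ := le_trans (le_max_left _ _) hτ
  have hτY₁ : Y₁ ≤ im τ := le_trans (le_max_right _ _) hτ
  have h1 := h τ hτY
  have h2 : ‖G τ - b‖ ≤ ‖b‖ / 2 := h1.trans (hY₁ _ hτY₁)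
  have h3 : ‖b‖ / 2 ≤ ‖G τ‖ := by
    have := norm_sub_norm_le b (G τ)
    rw [norm_sub_rev] at this
    linarith
  have hG0 : G τ ≠ 0 := by
    intro h0; rw [h0, norm_zero] at h3; linarith
  rw [inv_sub_inv hG0 hb, norm_div, norm_mul, norm_sub_rev]
  rw [div_le_iff₀ (by positivity)]
  calc ‖G τ - b‖ ≤ C * rexp (-(π * im τ)) := h1
    _ = 2 * C / ‖b‖ ^ 2 * rexp (-(π * im τ)) * (‖b‖ / 2 * ‖b‖) := by
        field_simp
    _ ≤ 2 * C / ‖b‖ ^ 2 * rexp (-(π * im τ)) * (‖G τ‖ * ‖b‖) := by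
        apply mul_le_mul_of_nonneg_left _ (by positivity)
        exact mul_le_mul_of_nonneg_right h3 (norm_nonneg _)

/-- Quotients. [folklore] -/
theorem div (hF : IsBigOqhat F a) (hG : IsBigOqhat G b) (hb : b ≠ 0) :
    IsBigOqhat (fun τ => F τ / G τ) (a / b) := by
  simpa [div_eq_mul_inv] using hF.mul (hG.inv hb)

/-- `q̂ · (bounded) = O(q̂)`. [folklore] -/
theorem of_qhat_mul (hF : ∃ M Y : ℝ, ∀ τ : ℂ, Y ≤ im τ → ‖F τ‖ ≤ M) :
    IsBigOqhat (fun τ => qhat τ * F τ) 0 := by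
  obtain ⟨M, Y, h⟩ := hF
  refine ⟨M, Y, fun τ hτ => ?_⟩
  rw [sub_zero, norm_mul, norm_qhat, mul_comm]
  exact mul_le_mul_of_nonneg_right (h τ hτ) (Real.exp_pos _).le

/-- `q̂ · (c₀ + O(q̂)) = O(q̂)`. [folklore] -/
theorem qhat_mul (hF : IsBigOqhat F a) : IsBigOqhat (fun τ => qhat τ * F τ) 0 := by
  obtain ⟨M, Y, -, -, h⟩ := hF.norm_le
  exact of_qhat_mul ⟨M, Y, h⟩

/-- The limit at `i∞`. [folklore] -/
theorem tendsto (hF : IsBigOqhat F a) : Tendsto F (comap im atTop) (𝓝 a) := by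
  obtain ⟨C, Y, hC, hY, h⟩ := hF.bound'
  rw [tendsto_iff_norm_sub_tendsto_zero]
  have hlim : Tendsto (fun τ : ℂ => C * rexp (-(π * im τ))) (comap im atTop) (𝓝 0) := by
    have ht : Tendsto (fun y : ℝ => C * rexp (-(π * y))) atTop (𝓝 (C * 0)) := by
      refine (Real.tendsto_exp_atBot.comp ?_).const_mul C
      exact tendsto_neg_atTop_atBot.comp (tendsto_id.const_mul_atTop Real.pi_pos)
    rw [mul_zero] at ht
    exact ht.comp tendsto_comap
  refine squeeze_zero' (Eventually.of_forall fun τ => norm_nonneg _) ?_ hlim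
  have hmem : {τ : ℂ | Y ≤ im τ} ∈ comap im atTop := ⟨Set.Ici Y, Ici_mem_atTop Y, fun τ h => h⟩
  filter_upwards [hmem] with τ hτ using h τ hτ

end IsBigOqhat

variable {c : ℕ → ℂ} {C : ℝ} {m : ℕ}

/-- A polynomially bounded power series is bounded on `‖w‖ ≤ e^{-π}`. [folklore] -/
theorem norm_discFun_le_of_norm_le_exp (hc : ∀ n, ‖c n‖ ≤ C * ((n : ℝ) + 1) ^ m) (hC : 0 ≤ C)
    {w : ℂ} (hw : ‖w‖ ≤ rexp (-π)) :
    ‖discFun c w‖ ≤ C * m.factorial / (1 - rexp (-π)) ^ (m + 1) := by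
  have he1 : rexp (-π) < 1 := by
    rw [← Real.exp_zero]; exact Real.exp_lt_exp.mpr (by linarith [Real.pi_pos])
  have hw1 : ‖w‖ < 1 := lt_of_le_of_lt hw he1
  refine (norm_discFun_le hc hC hw1).trans ?_
  apply div_le_div_of_nonneg_left (by positivity) (pow_pos (by linarith) _)
  exact pow_le_pow_left₀ (by linarith) (by linarith) _

/-- **`∑ cₙ q̂ⁿ = c₀ + O(q̂)`.** [folklore] -/
theorem isBigOqhat_discFun_qhat (hc : ∀ n, ‖c n‖ ≤ C * ((n : ℝ) + 1) ^ m) (hC : 0 ≤ C) :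
    IsBigOqhat (fun τ => discFun c (qhat τ)) (c 0) := by
  have hsh := norm_shift_le hc hC
  refine ⟨2 ^ m * C * m.factorial / (1 - rexp (-π)) ^ (m + 1), 1, fun τ hτ => ?_⟩
  have hτ' : 0 < im τ := by linarith
  have hq : ‖qhat τ‖ < 1 := norm_qhat_lt_one hτ'
  have hqe : ‖qhat τ‖ ≤ rexp (-π) := by
    rw [norm_qhat, Real.exp_le_exp]; nlinarith [Real.pi_pos]
  show ‖discFun c (qhat τ) - c 0‖ ≤ _
  rw [discFun_eq_zero_add hc hC hq, add_sub_cancel_left, norm_mul, norm_qhat, mul_comm]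
  exact mul_le_mul_of_nonneg_right (norm_discFun_le_of_norm_le_exp hsh (by positivity) hqe)
    (Real.exp_pos _).le

/-- **`∑ cₙ (-q̂)ⁿ = c₀ + O(q̂)`.** [folklore] -/
theorem isBigOqhat_discFun_neg_qhat (hc : ∀ n, ‖c n‖ ≤ C * ((n : ℝ) + 1) ^ m) (hC : 0 ≤ C) :
    IsBigOqhat (fun τ => discFun c (-qhat τ)) (c 0) := by
  have hsh := norm_shift_le hc hC
  refine ⟨2 ^ m * C * m.factorial / (1 - rexp (-π)) ^ (m + 1), 1, fun τ hτ => ?_⟩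
  have hτ' : 0 < im τ := by linarith
  have hq : ‖-qhat τ‖ < 1 := by rw [norm_neg]; exact norm_qhat_lt_one hτ'
  have hqe : ‖-qhat τ‖ ≤ rexp (-π) := by
    rw [norm_neg, norm_qhat, Real.exp_le_exp]; nlinarith [Real.pi_pos]
  show ‖discFun c (-qhat τ) - c 0‖ ≤ _
  rw [discFun_eq_zero_add hc hC hq, add_sub_cancel_left, norm_mul, norm_neg, norm_qhat, mul_comm]
  exact mul_le_mul_of_nonneg_right (norm_discFun_le_of_norm_le_exp hsh (by positivity) hqe)
    (Real.exp_pos _).le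

/-- `(∑ cₙ wⁿ)′(q̂) = c₁ + O(q̂)`. [folklore] -/
theorem isBigOqhat_deriv_discFun_qhat (hc : ∀ n, ‖c n‖ ≤ C * ((n : ℝ) + 1) ^ m) (hC : 0 ≤ C) :
    IsBigOqhat (fun τ => deriv (discFun c) (qhat τ)) (c 1) := by
  have h := isBigOqhat_discFun_qhat (norm_derivCoef_le hc hC) (by positivity)
  have e : derivCoef c 0 = c 1 := by simp [derivCoef]
  rw [e] at h
  exact h.congr' fun τ hτ => (deriv_discFun_eq hc hC (norm_qhat_lt_one hτ)).symm

/-- `(∑ cₙ wⁿ)′(-q̂) = c₁ + O(q̂)`. [folklore] -/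
theorem isBigOqhat_deriv_discFun_neg_qhat (hc : ∀ n, ‖c n‖ ≤ C * ((n : ℝ) + 1) ^ m)
    (hC : 0 ≤ C) : IsBigOqhat (fun τ => deriv (discFun c) (-qhat τ)) (c 1) := by
  have h := isBigOqhat_discFun_neg_qhat (norm_derivCoef_le hc hC) (by positivity)
  have e : derivCoef c 0 = c 1 := by simp [derivCoef]
  rw [e] at h
  refine h.congr' fun τ hτ => (deriv_discFun_eq hc hC ?_).symm
  rw [norm_neg]; exact norm_qhat_lt_one hτ

end BigOqhat

/-! ### Logarithmic derivatives of the thetanulls -/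

section ThetaLogDeriv

open Literature.NumberTheory.EllipticCurves.JacobiThetaNull

variable {τ : ℂ}

/-- `θ₃′ = G₃′(q̂) · πi q̂` on `ℍ` (`G₃ = ∑ c3ₘ wᵐ`). [folklore] -/
theorem hasDerivAt_theta3 (hτ : 0 < im τ) :
    HasDerivAt theta3 (deriv (discFun c3) (qhat τ) * (π * I * qhat τ)) τ := by
  have hev : theta3 =ᶠ[𝓝 τ] fun z => discFun c3 (qhat z) := by
    filter_upwards [isOpen_upperHalfPlaneSet'.mem_nhds hτ] with z hz using theta3_eq_discFun hz
  have h : HasDerivAt (fun z => discFun c3 (qhat z))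
      (deriv (discFun c3) (qhat τ) * (π * I * qhat τ)) τ :=
    (differentiableAt_discFun norm_c3_le (by norm_num) (norm_qhat_lt_one hτ)).hasDerivAt.comp τ
      (hasDerivAt_qhat τ)
  exact h.congr_of_eventuallyEq hev

/-- `θ₄′ = -G₃′(-q̂) · πi q̂` on `ℍ`. [folklore] -/
theorem hasDerivAt_theta4 (hτ : 0 < im τ) :
    HasDerivAt theta4 (deriv (discFun c3) (-qhat τ) * (-(π * I * qhat τ))) τ := by
  have hev : theta4 =ᶠ[𝓝 τ] fun z => discFun c3 (-qhat z) := by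
    filter_upwards [isOpen_upperHalfPlaneSet'.mem_nhds hτ] with z hz using theta4_eq_discFun hz
  have hq : ‖-qhat τ‖ < 1 := by rw [norm_neg]; exact norm_qhat_lt_one hτ
  have hn : HasDerivAt (fun z : ℂ => -qhat z) (-(π * I * qhat τ)) τ := (hasDerivAt_qhat τ).fun_neg
  have h : HasDerivAt (discFun c3 ∘ fun z : ℂ => -qhat z)
      (deriv (discFun c3) (-qhat τ) * (-(π * I * qhat τ))) τ :=
    HasDerivAt.comp τ (by exact (differentiableAt_discFun norm_c3_le (by norm_num) hq).hasDerivAt) hn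
  exact h.congr_of_eventuallyEq hev

/-- `θ₂′ = e^{πiτ/4}[(πi/4) G₂(q̂) + G₂′(q̂) πi q̂]` on `ℍ`. [folklore] -/
theorem hasDerivAt_theta2 (hτ : 0 < im τ) :
    HasDerivAt theta2 (cexp (π * I * τ / 4) * (π * I / 4) * discFun c2 (qhat τ) +
      cexp (π * I * τ / 4) * (deriv (discFun c2) (qhat τ) * (π * I * qhat τ))) τ := by
  have hev : theta2 =ᶠ[𝓝 τ] fun z => cexp (π * I * z / 4) * discFun c2 (qhat z) := by
    filter_upwards [isOpen_upperHalfPlaneSet'.mem_nhds hτ] with z hz using theta2_eq_discFun hz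
  have hE : HasDerivAt (fun z : ℂ => cexp (π * I * z / 4)) (cexp (π * I * τ / 4) * (π * I / 4)) τ := by
    have : HasDerivAt (fun z : ℂ => π * I * z / 4) (π * I / 4) τ := by
      have h := ((hasDerivAt_id τ).const_mul (π * I)).div_const 4
      simpa using h
    exact this.cexp
  have hD : HasDerivAt (fun z => discFun c2 (qhat z))
      (deriv (discFun c2) (qhat τ) * (π * I * qhat τ)) τ :=
    (differentiableAt_discFun norm_c2_le (by norm_num) (norm_qhat_lt_one hτ)).hasDerivAt.comp τ
      (hasDerivAt_qhat τ)
  exact (hE.fun_mul hD).congr_of_eventuallyEq hev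

/-- `G₂(q̂(τ)) ≠ 0` on `ℍ` (as `θ₂ ≠ 0`). [folklore] -/
theorem discFun_c2_ne_zero (hτ : 0 < im τ) : discFun c2 (qhat τ) ≠ 0 := by
  intro h
  apply theta2_ne_zero' hτ
  rw [theta2_eq_discFun hτ, h, mul_zero]

/-- `G₃(q̂(τ)) ≠ 0` on `ℍ`. [folklore] -/
theorem discFun_c3_ne_zero (hτ : 0 < im τ) : discFun c3 (qhat τ) ≠ 0 := by
  rw [← theta3_eq_discFun hτ]; exact theta3_ne_zero' hτ

/-- `G₃(-q̂(τ)) ≠ 0` on `ℍ`. [folklore] -/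
theorem discFun_c3_neg_ne_zero (hτ : 0 < im τ) : discFun c3 (-qhat τ) ≠ 0 := by
  rw [← theta4_eq_discFun hτ]; exact theta4_ne_zero' hτ

/-- **`θ₃′/θ₃ = q̂ · πi G₃′(q̂)/G₃(q̂)`.** [folklore] -/
theorem logDeriv_theta3_eq (hτ : 0 < im τ) :
    logDeriv theta3 τ = qhat τ * (π * I * deriv (discFun c3) (qhat τ) / discFun c3 (qhat τ)) := by
  rw [logDeriv_apply, (hasDerivAt_theta3 hτ).deriv, theta3_eq_discFun hτ]
  ring

/-- **`θ₄′/θ₄ = q̂ · (-πi) G₃′(-q̂)/G₃(-q̂)`.** [folklore] -/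
theorem logDeriv_theta4_eq (hτ : 0 < im τ) :
    logDeriv theta4 τ =
      qhat τ * (-(π * I) * deriv (discFun c3) (-qhat τ) / discFun c3 (-qhat τ)) := by
  rw [logDeriv_apply, (hasDerivAt_theta4 hτ).deriv, theta4_eq_discFun hτ]
  ring

/-- **`θ₂′/θ₂ = πi/4 + q̂ · πi G₂′(q̂)/G₂(q̂)`.** [folklore] -/
theorem logDeriv_theta2_eq (hτ : 0 < im τ) :
    logDeriv theta2 τ =
      π * I / 4 + qhat τ * (π * I * deriv (discFun c2) (qhat τ) / discFun c2 (qhat τ)) := by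
  have hE : cexp (π * I * τ / 4) ≠ 0 := Complex.exp_ne_zero _
  have hD := discFun_c2_ne_zero hτ
  rw [logDeriv_apply, (hasDerivAt_theta2 hτ).deriv, theta2_eq_discFun hτ]
  field_simp

/-- **`θ₃′/θ₃ = O(q̂)`.** [folklore] -/
theorem isBigOqhat_logDeriv_theta3 : IsBigOqhat (logDeriv theta3) 0 := by
  have h1 := isBigOqhat_deriv_discFun_qhat norm_c3_le (by norm_num : (0 : ℝ) ≤ 2)
  have h2 := isBigOqhat_discFun_qhat norm_c3_le (by norm_num : (0 : ℝ) ≤ 2)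
  have h3 := ((IsBigOqhat.const (π * I)).mul h1).div h2 (by simp [c3])
  exact (h3.qhat_mul).congr' fun τ hτ => by rw [logDeriv_theta3_eq hτ]

/-- **`θ₄′/θ₄ = O(q̂)`.** [folklore] -/
theorem isBigOqhat_logDeriv_theta4 : IsBigOqhat (logDeriv theta4) 0 := by
  have h1 := isBigOqhat_deriv_discFun_neg_qhat norm_c3_le (by norm_num : (0 : ℝ) ≤ 2)
  have h2 := isBigOqhat_discFun_neg_qhat norm_c3_le (by norm_num : (0 : ℝ) ≤ 2)
  have h3 := ((IsBigOqhat.const (-(π * I))).mul h1).div h2 (by simp [c3])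
  exact (h3.qhat_mul).congr' fun τ hτ => by rw [logDeriv_theta4_eq hτ]

/-- **`θ₂′/θ₂ = πi/4 + O(q̂)`.** [folklore] -/
theorem isBigOqhat_logDeriv_theta2 : IsBigOqhat (logDeriv theta2) (π * I / 4) := by
  have h1 := isBigOqhat_deriv_discFun_qhat norm_c2_le (by norm_num : (0 : ℝ) ≤ 2)
  have h2 := isBigOqhat_discFun_qhat norm_c2_le (by norm_num : (0 : ℝ) ≤ 2)
  have h3 := ((IsBigOqhat.const (π * I)).mul h1).div h2 (by rw [c2_zero]; norm_num)
  have h4 := (IsBigOqhat.const (π * I / 4)).add h3.qhat_mul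
  rw [add_zero] at h4
  exact h4.congr' fun τ hτ => by rw [logDeriv_theta2_eq hτ]

/-- `θ₃ = 1 + O(q̂)`. [folklore] -/
theorem isBigOqhat_theta3 : IsBigOqhat theta3 1 := by
  have h := isBigOqhat_discFun_qhat norm_c3_le (by norm_num : (0 : ℝ) ≤ 2)
  have e : c3 0 = 1 := by simp [c3]
  rw [e] at h
  exact h.congr' fun τ hτ => (theta3_eq_discFun hτ).symm

/-- `θ₄ = 1 + O(q̂)`. [folklore] -/
theorem isBigOqhat_theta4 : IsBigOqhat theta4 1 := by
  have h := isBigOqhat_discFun_neg_qhat norm_c3_le (by norm_num : (0 : ℝ) ≤ 2)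
  have e : c3 0 = 1 := by simp [c3]
  rw [e] at h
  exact h.congr' fun τ hτ => (theta4_eq_discFun hτ).symm

/-- `θ₂⁴ = O(q̂)` (`θ₂⁴ = q̂ G₂(q̂)⁴`). [folklore] -/
theorem isBigOqhat_theta2_pow_four : IsBigOqhat (fun τ => theta2 τ ^ 4) 0 := by
  have h := (isBigOqhat_discFun_qhat norm_c2_le (by norm_num : (0 : ℝ) ≤ 2)).pow 4
  refine h.qhat_mul.congr' fun τ hτ => ?_
  rw [theta2_eq_discFun hτ, mul_pow, ← Complex.exp_nat_mul, qhat]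
  congr 2
  push_cast
  ring

/-! #### Behaviour under `τ ↦ τ + 1` -/

/-- `(θ₃′/θ₃)(τ+1) = (θ₄′/θ₄)(τ)`. [folklore] -/
theorem logDeriv_theta3_add_one (τ : ℂ) : logDeriv theta3 (τ + 1) = logDeriv theta4 τ := by
  have h1 : deriv theta4 τ = deriv theta3 (τ + 1) := by
    rw [show theta4 = fun z => theta3 (z + 1) from funext fun z => (theta3_add_one z).symm]
    exact deriv_comp_add_const theta3 1 τ
  rw [logDeriv_apply, logDeriv_apply, h1, ← theta3_add_one]

/-- `(θ₄′/θ₄)(τ+1) = (θ₃′/θ₃)(τ)`. [folklore] -/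
theorem logDeriv_theta4_add_one (τ : ℂ) : logDeriv theta4 (τ + 1) = logDeriv theta3 τ := by
  have h1 : deriv theta3 τ = deriv theta4 (τ + 1) := by
    rw [show theta3 = fun z => theta4 (z + 1) from funext fun z => (theta4_add_one z).symm]
    exact deriv_comp_add_const theta4 1 τ
  rw [logDeriv_apply, logDeriv_apply, h1, ← theta4_add_one]

/-- `(θ₂′/θ₂)(τ+1) = (θ₂′/θ₂)(τ)`. [folklore] -/
theorem logDeriv_theta2_add_one (τ : ℂ) : logDeriv theta2 (τ + 1) = logDeriv theta2 τ := by
  have hE : cexp (π * I / 4) ≠ 0 := Complex.exp_ne_zero _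
  have h1 : deriv theta2 (τ + 1) = cexp (π * I / 4) * deriv theta2 τ := by
    rw [← deriv_comp_add_const theta2 1 τ,
      show (fun z => theta2 (z + 1)) = fun z => cexp (π * I / 4) * theta2 z from
        funext fun z => theta2_add_one z, deriv_const_mul_field']
  rw [logDeriv_apply, logDeriv_apply, h1, theta2_add_one, mul_div_mul_left _ _ hE]

/-! #### Behaviour under `τ ↦ -1/τ` -/

/-- **The `S`-law of a logarithmic derivative with half-integral weight factor**: if
`g(-1/z) = (-iz)^{1/2} h(z)` on `ℍ`, then `(g′/g)(-1/τ) = τ² (h′/h)(τ) + τ/2`. [folklore] -/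
theorem logDeriv_S_half_law {g h : ℂ → ℂ}
    (hlaw : ∀ z : ℂ, 0 < im z → g (-1 / z) = (-I * z) ^ (1 / 2 : ℂ) * h z)
    (hτ : 0 < im τ) (hg : DifferentiableAt ℂ g (-1 / τ)) (hh : DifferentiableAt ℂ h τ)
    (hhτ : h τ ≠ 0) :
    logDeriv g (-1 / τ) = τ ^ 2 * logDeriv h τ + τ / 2 := by
  have hτ0 : τ ≠ 0 := ne_zero_of_im_pos hτ
  have hev : (fun z => g (-1 / z)) =ᶠ[𝓝 τ] fun z => (-I * z) ^ (1 / 2 : ℂ) * h z := by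
    filter_upwards [isOpen_upperHalfPlaneSet'.mem_nhds hτ] with z hz using hlaw z hz
  have hd := hev.deriv_eq
  have h0 : HasDerivAt (fun z : ℂ => -1 / z) (1 / τ ^ 2) τ := by
    have h := (hasDerivAt_inv hτ0).const_mul (-1 : ℂ)
    refine (h.congr_of_eventuallyEq ?_).congr_deriv (by ring)
    exact Eventually.of_forall fun z => by simp [div_eq_mul_inv]
  have h1 : HasDerivAt (fun z => g (-1 / z)) (deriv g (-1 / τ) * (1 / τ ^ 2)) τ :=
    hg.hasDerivAt.comp τ h0
  have hslit : -I * τ ∈ Complex.slitPlane := by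
    rw [Complex.mem_slitPlane_iff]
    left
    simpa using hτ
  have hs : HasDerivAt (fun z : ℂ => (-I * z) ^ (1 / 2 : ℂ))
      ((1 / 2 : ℂ) * (-I * τ) ^ ((1 / 2 : ℂ) - 1) * (-I)) τ := by
    have hlin : HasDerivAt (fun z : ℂ => -I * z) (-I * 1) τ := (hasDerivAt_id τ).const_mul (-I)
    rw [mul_one] at hlin
    exact hlin.cpow_const hslit
  have h2 := hs.fun_mul hh.hasDerivAt
  rw [h1.deriv, h2.deriv] at hd
  set s : ℂ := (-I * τ) ^ (1 / 2 : ℂ) with hsdef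
  have hs0 : s ≠ 0 := cpow_half_ne_zero hτ
  have hsI : -I * τ ≠ 0 := neg_I_mul_ne_zero hτ
  have hI : (-I : ℂ) ≠ 0 := neg_ne_zero.mpr I_ne_zero
  have hs' : (1 / 2 : ℂ) * (-I * τ) ^ ((1 / 2 : ℂ) - 1) * (-I) = s / (2 * τ) := by
    rw [Complex.cpow_sub _ _ hsI, Complex.cpow_one, ← hsdef]
    field_simp
  have hd' : deriv g (-1 / τ) = τ ^ 2 * (s / (2 * τ) * h τ + s * deriv h τ) := by
    have := congrArg (· * τ ^ 2) hd
    rw [one_div, inv_mul_cancel_right₀ (pow_ne_zero 2 hτ0)] at this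
    rw [this, hs', mul_comm]
  rw [logDeriv_apply, logDeriv_apply, hd', hlaw τ hτ, ← hsdef]
  field_simp
  ring

/-- **`(θ₃′/θ₃)(-1/τ) = τ² (θ₃′/θ₃)(τ) + τ/2`.** [folklore] -/
theorem logDeriv_theta3_neg_one_div (hτ : 0 < im τ) :
    logDeriv theta3 (-1 / τ) = τ ^ 2 * logDeriv theta3 τ + τ / 2 :=
  logDeriv_S_half_law (fun _ hz => theta3_neg_one_div hz) hτ
    (differentiableAt_theta3 (im_neg_one_div_pos hτ)) (differentiableAt_theta3 hτ)
    (theta3_ne_zero' hτ)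

/-- **`(θ₄′/θ₄)(-1/τ) = τ² (θ₂′/θ₂)(τ) + τ/2`.** [folklore] -/
theorem logDeriv_theta4_neg_one_div (hτ : 0 < im τ) :
    logDeriv theta4 (-1 / τ) = τ ^ 2 * logDeriv theta2 τ + τ / 2 :=
  logDeriv_S_half_law (fun _ hz => theta4_neg_one_div hz) hτ
    (differentiableAt_theta4 (im_neg_one_div_pos hτ)) (differentiableAt_theta2 hτ)
    (theta2_ne_zero' hτ)

/-- **`(θ₂′/θ₂)(-1/τ) = τ² (θ₄′/θ₄)(τ) + τ/2`.** [folklore] -/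
theorem logDeriv_theta2_neg_one_div (hτ : 0 < im τ) :
    logDeriv theta2 (-1 / τ) = τ ^ 2 * logDeriv theta4 τ + τ / 2 :=
  logDeriv_S_half_law (fun _ hz => theta2_neg_one_div hz) hτ
    (differentiableAt_theta2 (im_neg_one_div_pos hτ)) (differentiableAt_theta4 hτ)
    (theta4_ne_zero' hτ)

/-- The logarithmic derivative of a holomorphic function is holomorphic off its zeros.
[folklore] -/
theorem differentiableAt_logDeriv {f : ℂ → ℂ}
    (hf : ∀ z : ℂ, 0 < im z → DifferentiableAt ℂ f z) (hτ : 0 < im τ) (hne : f τ ≠ 0) :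
    DifferentiableAt ℂ (logDeriv f) τ := by
  have hfd : DifferentiableOn ℂ f {z : ℂ | 0 < z.im} := fun z hz => (hf z hz).differentiableWithinAt
  have hA : AnalyticAt ℂ f τ := hfd.analyticAt (isOpen_upperHalfPlaneSet'.mem_nhds hτ)
  have hd : DifferentiableAt ℂ (deriv f) τ := hA.deriv.differentiableAt
  have := hd.div (hf τ hτ) hne
  exact this

end ThetaLogDeriv

/-! ### `λ′ = πi ϑ₄⁴ λ`: the logarithmic derivative of the elliptic modulus -/

section LambdaDeriv

open Literature.NumberTheory.EllipticCurves.JacobiThetaNull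

/-- The defect `z(τ) = 4(θ₂′/θ₂ - θ₃′/θ₃) - πi θ₄⁴ = λ′/λ - πi θ₄⁴` (`λ = θ₂⁴/θ₃⁴`); the
classical formula `λ′ = πi θ₄⁴ λ` says `z = 0`. [folklore] -/
def lamDefect (τ : ℂ) : ℂ := 4 * (logDeriv theta2 τ - logDeriv theta3 τ) - π * I * theta4 τ ^ 4

/-- Its `T`-translate `z₃ = z(·+1) = 4(θ₂′/θ₂ - θ₄′/θ₄) - πi θ₃⁴`, anti-invariant under `S`.
[folklore] -/
def lamDefectT (τ : ℂ) : ℂ := 4 * (logDeriv theta2 τ - logDeriv theta4 τ) - π * I * theta3 τ ^ 4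

/-- Its `S`-conjugate `z₂ = 4(θ₄′/θ₄ - θ₃′/θ₃) + πi θ₂⁴`. [folklore] -/
def lamDefectS (τ : ℂ) : ℂ := 4 * (logDeriv theta4 τ - logDeriv theta3 τ) + π * I * theta2 τ ^ 4

variable {τ : ℂ}

/-- `z(τ+1) = z₃(τ)`. [folklore] -/
theorem lamDefect_add_one (τ : ℂ) : lamDefect (τ + 1) = lamDefectT τ := by
  rw [lamDefect, lamDefectT, logDeriv_theta2_add_one, logDeriv_theta3_add_one, theta4_add_one]

/-- `z₃(τ+1) = z(τ)`. [folklore] -/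
theorem lamDefectT_add_one (τ : ℂ) : lamDefectT (τ + 1) = lamDefect τ := by
  rw [lamDefect, lamDefectT, logDeriv_theta2_add_one, logDeriv_theta4_add_one, theta3_add_one]

/-- `z₃(τ+2) = z₃(τ)`. [folklore] -/
theorem lamDefectT_add_two (τ : ℂ) : lamDefectT (τ + 2) = lamDefectT τ := by
  rw [show τ + 2 = τ + 1 + 1 by ring, lamDefectT_add_one, lamDefect_add_one]

/-- **`z₃(-1/τ) = -τ² z₃(τ)`** (from the `S`-laws of the `θ_j′/θ_j` and `θ₃(-1/τ)⁴ = -τ²θ₃⁴`).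
[folklore] -/
theorem lamDefectT_neg_one_div (hτ : 0 < im τ) : lamDefectT (-1 / τ) = -τ ^ 2 * lamDefectT τ := by
  rw [lamDefectT, lamDefectT, logDeriv_theta2_neg_one_div hτ, logDeriv_theta4_neg_one_div hτ,
    theta3_neg_one_div hτ, mul_pow, cpow_half_pow_four]
  ring

/-- **`(z₃|₂TS)(τ) = z₂(τ)`**: `z₃((τ-1)/τ) = z(-1/τ) = τ² z₂(τ)`. [folklore] -/
theorem slashTS_lamDefectT (hτ : 0 < im τ) : slashTS lamDefectT τ = lamDefectS τ := by
  have hτ0 : τ ≠ 0 := ne_zero_of_im_pos hτ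
  have e1 : (τ - 1) / τ = -1 / τ + 1 := by
    rw [div_add' _ _ _ hτ0]
    congr 1
    ring
  rw [slashTS, e1, lamDefectT_add_one, lamDefect, logDeriv_theta2_neg_one_div hτ,
    logDeriv_theta3_neg_one_div hτ, theta4_neg_one_div hτ, mul_pow, cpow_half_pow_four, lamDefectS]
  field_simp
  ring

/-- `z₃` is holomorphic on `ℍ`. [folklore] -/
theorem differentiableAt_lamDefectT (hτ : 0 < im τ) : DifferentiableAt ℂ lamDefectT τ := by
  have h2 := differentiableAt_logDeriv (fun z hz => differentiableAt_theta2 hz) hτ (theta2_ne_zero' hτ)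
  have h4 := differentiableAt_logDeriv (fun z hz => differentiableAt_theta4 hz) hτ (theta4_ne_zero' hτ)
  have h3 := (differentiableAt_theta3 hτ).pow 4
  unfold lamDefectT
  exact ((h2.sub h4).const_mul 4).sub (h3.const_mul (π * I))

/-- `z₃ = O(q̂)`. [folklore] -/
theorem isBigOqhat_lamDefectT : IsBigOqhat lamDefectT 0 := by
  have h := ((isBigOqhat_logDeriv_theta2.sub isBigOqhat_logDeriv_theta4).const_mul 4).sub
    ((isBigOqhat_theta3.pow 4).const_mul (π * I))
  have e : (4 : ℂ) * (π * I / 4 - 0) - π * I * 1 ^ 4 = 0 := by ring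
  rw [e] at h
  exact h

/-- `z = O(q̂)`. [folklore] -/
theorem isBigOqhat_lamDefect : IsBigOqhat lamDefect 0 := by
  have h := ((isBigOqhat_logDeriv_theta2.sub isBigOqhat_logDeriv_theta3).const_mul 4).sub
    ((isBigOqhat_theta4.pow 4).const_mul (π * I))
  have e : (4 : ℂ) * (π * I / 4 - 0) - π * I * 1 ^ 4 = 0 := by ring
  rw [e] at h
  exact h

/-- `z₂ = O(q̂)`. [folklore] -/
theorem isBigOqhat_lamDefectS : IsBigOqhat lamDefectS 0 := by
  have h := ((isBigOqhat_logDeriv_theta4.sub isBigOqhat_logDeriv_theta3).const_mul 4).add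
    (isBigOqhat_theta2_pow_four.const_mul (π * I))
  have e : (4 : ℂ) * (0 - 0) + π * I * 0 = 0 := by ring
  rw [e] at h
  exact h

/-- **`z₃ = 0` on `ℍ`**: `z₃` is holomorphic, `2`-periodic, `z₃|₂S = -z₃`, and
`N(z₃) = z₃ · z · z₂ = O(q̂³)` decays faster than `e^{-πy}`, so `eq_zero_minus_of_fast_decay`
applies. [folklore] -/
theorem lamDefectT_eq_zero (hτ : 0 < im τ) : lamDefectT τ = 0 := by
  obtain ⟨C₁, Y₁, hC₁, hY₁, h₁⟩ := isBigOqhat_lamDefectT.bound'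
  obtain ⟨C₂, Y₂, hC₂, hY₂, h₂⟩ := isBigOqhat_lamDefect.bound'
  obtain ⟨C₃, Y₃, hC₃, hY₃, h₃⟩ := isBigOqhat_lamDefectS.bound'
  set Y : ℝ := max Y₁ (max Y₂ Y₃) with hY
  have hYpos : 0 < Y := lt_of_lt_of_le hY₁ (le_max_left _ _)
  have hN : ∀ σ : ℂ, Y ≤ im σ → ‖normTS lamDefectT σ‖ ≤ C₁ * C₂ * C₃ * rexp (-(3 * π * im σ)) := by
    intro σ hσ
    have hσ' : 0 < im σ := lt_of_lt_of_le hYpos hσ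
    have hσ1 : Y₁ ≤ im σ := le_trans (le_max_left _ _) hσ
    have hσ2 : Y₂ ≤ im σ := le_trans (le_trans (le_max_left _ _) (le_max_right _ _)) hσ
    have hσ3 : Y₃ ≤ im σ := le_trans (le_trans (le_max_right _ _) (le_max_right _ _)) hσ
    have e : normTS lamDefectT σ = lamDefectT σ * lamDefect σ * lamDefectS σ := by
      rw [normTS, lamDefectT_add_one, slashTS_lamDefectT hσ']
    have b1 := h₁ σ hσ1
    have b2 := h₂ σ hσ2
    have b3 := h₃ σ hσ3
    rw [sub_zero] at b1 b2 b3
    rw [e, norm_mul, norm_mul]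
    have e3 : rexp (-(3 * π * im σ)) = rexp (-(π * im σ)) * rexp (-(π * im σ)) * rexp (-(π * im σ)) := by
      rw [← Real.exp_add, ← Real.exp_add]; ring_nf
    rw [e3]
    calc ‖lamDefectT σ‖ * ‖lamDefect σ‖ * ‖lamDefectS σ‖
        ≤ C₁ * rexp (-(π * im σ)) * (C₂ * rexp (-(π * im σ))) * (C₃ * rexp (-(π * im σ))) :=
          mul_le_mul (mul_le_mul b1 b2 (norm_nonneg _) (by positivity)) b3 (norm_nonneg _)
            (by positivity)
      _ = _ := by ring
  have hB : Tendsto (fun y : ℝ => C₁ * C₂ * C₃ * rexp (-(3 * π * y))) atTop (𝓝 0) := by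
    have ht : Tendsto (fun y : ℝ => C₁ * C₂ * C₃ * rexp (-(3 * π * y))) atTop (𝓝 (C₁ * C₂ * C₃ * 0)) := by
      refine (Real.tendsto_exp_atBot.comp ?_).const_mul _
      exact tendsto_neg_atTop_atBot.comp (tendsto_id.const_mul_atTop (by positivity))
    rwa [mul_zero] at ht
  refine eq_zero_minus_of_fast_decay (f := lamDefectT) (A := 1) one_ne_zero
    (fun z hz => differentiableAt_lamDefectT hz)
    (fun z _ => by rw [lamDefectT_add_two, one_mul])
    (fun z hz => lamDefectT_neg_one_div hz) hB hYpos
    (fun σ hσ _ _ => hN σ hσ) ⟨C₁ * C₂ * C₃, 2 * π, by positivity, fun t ht => ?_⟩ hτ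
  have him : im (I * t : ℂ) = t := by simp
  have := hN (I * t) (by rw [him]; exact ht)
  rw [him] at this
  convert this using 2
  ring

/-- **`λ′ = πi ϑ₄⁴ λ`** in logarithmic form: `4(θ₂′/θ₂ - θ₃′/θ₃) = πi θ₄⁴` on `ℍ`
(`λ = θ₂⁴/θ₃⁴`; Kleban–Zagier §3, eq. (der): `λ′/(2πi) = ½ θ₄⁴ λ`). [cite: KlebanZagier2003, §3] -/
theorem four_mul_logDeriv_theta2_sub_theta3 (hτ : 0 < im τ) :
    4 * (logDeriv theta2 τ - logDeriv theta3 τ) = π * I * theta4 τ ^ 4 := by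
  have h := lamDefectT_eq_zero (τ := τ + 1) (by simpa using hτ)
  rw [lamDefectT_add_one, lamDefect] at h
  exact sub_eq_zero.mp h

/-- **`(1-λ)′ = -πi ϑ₂⁴ (1-λ)`** in logarithmic form: `4(θ₄′/θ₄ - θ₃′/θ₃) = -πi θ₂⁴` on `ℍ`.
[cite: KlebanZagier2003, §3] -/
theorem four_mul_logDeriv_theta4_sub_theta3 (hτ : 0 < im τ) :
    4 * (logDeriv theta4 τ - logDeriv theta3 τ) = -(π * I * theta2 τ ^ 4) := by
  have h := lamDefectT_eq_zero (τ := (τ - 1) / τ) (im_sub_one_div_self_pos hτ)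
  have h2 : lamDefectS τ = 0 := by
    rw [← slashTS_lamDefectT hτ, slashTS, h, mul_zero]
  rw [lamDefectS] at h2
  exact eq_neg_of_add_eq_zero_left h2

end LambdaDeriv

end Literature.Probability.RandomPlanarGeometry.KlebanZagier

end
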